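import Summits.Ventures.DiscreteObjects.Hadamard.CompositeOrder161
import Summits.Ventures.DiscreteObjects.Hadamard.PrimeOrderFixedRows668

/-!
# Hadamard 668 census, family F12 — a composite-order table: products of two distinct primes that are NOT orders of automorphisms of H(668) (kernel)

Framing: lottery ticket; floor = certified bounds/negative ranges.

Cell pub-namedobj (venture DiscreteObjects), target (H), hadamard gen 11.  Census line (4) (kernel): the prime orders of signed
automorphisms of a Hadamard matrix of order `668` lie in `{2,3,5,7,11,13,23,37,41,83,167}`, with the fixed structure of every prime
`p ≥ 13` known (`hadamard668_signedAut_fixedRows`: `(13,44), (23,1|24), (37,2), (41,12), (83,4), (167,0)`) and windows for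
`p ∈ {3,5,7,11}` (`hadamard668_signedAut_colClasses_window`).  By pure COUNTING — the two parts of an automorphism pair of order
`p·q` commute, so (`dvd_card_moved_fixed`) `p` divides the number of columns moved by the `p`-part and fixed by the `q`-part and
vice versa (`counting_cols`, a statement about one permutation `κ` with `κ^(pq) = 1`) — the following products of two distinct
primes are NOT orders of the permutation pair of a signed automorphism of any H(668):
* every `p·q` with `p ≠ q` both `≥ 13` (`no_hadamard668_signedAut_order_two_primes_ge_13`; 15 products `299, 481, …, 13861`);
* `p·q` for `(p,q) ∈ {5,7,11} × {37,83,167} ∪ {(7,41), (11,41), (3,83), (3,167)}` (`no_hadamard668_signedAut_order_small_large`;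
  13 products `185, 259, 407, 287, 451, 249, 415, 581, 913, 501, 835, 1169, 1837`);
together with `115, 161, 253` (`CompositeOrder23`, `CompositeOrder161`: rank inequality and PAF lemma) this is the summary
**`hadamard668_signedAut_not_dvd_orderOf`**: `p·q ∤ orderOf (π, κ)` for all 31 listed products (power trick: an element of order
`n` with `pq ∣ n` has a power of order `pq`, again a signed automorphism).  OPEN by these methods: `15, 21, 33, 35, 39, 55, 65, 69,
77, 91, 111, 123, 143` and `205 = 5·41` (the last needs the rank inequality for `p = 41`).  Ours, not literature; no `sorry`.
-/

namespace Summit.Ventures.DiscreteObjects.Hadamard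

open Finset BigOperators Matrix

open Literature.Combinatorics.Designs.GoethalsSeidel (IsHadamardMatrix)

variable {ι : Type*} [Fintype ι] [DecidableEq ι]

/-- **Counting constraints for one permutation with `κ^(pq) = 1`** (`p, q` prime): the fixed points of `κ^p` split into those
moved by `κ^q` (a multiple of `p`) and those fixed by `κ^q`; symmetrically for `κ^q`. -/
lemma counting_cols (κ : Equiv.Perm ι) {p q : ℕ} (hp : p.Prime) (hq : q.Prime) (hκ : κ ^ (p * q) = 1) :
    (univ.filter fun j => (κ ^ p) j = j).card
        = (univ.filter fun j => (κ ^ q) j ≠ j ∧ (κ ^ p) j = j).card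
          + (univ.filter fun j => (κ ^ q) j = j ∧ (κ ^ p) j = j).card ∧
    p ∣ (univ.filter fun j => (κ ^ q) j ≠ j ∧ (κ ^ p) j = j).card ∧
    (univ.filter fun j => (κ ^ q) j = j).card
        = (univ.filter fun j => (κ ^ p) j ≠ j ∧ (κ ^ q) j = j).card
          + (univ.filter fun j => (κ ^ q) j = j ∧ (κ ^ p) j = j).card ∧
    q ∣ (univ.filter fun j => (κ ^ p) j ≠ j ∧ (κ ^ q) j = j).card ∧
    (univ.filter fun j => (κ ^ q) j = j ∧ (κ ^ p) j = j).card ≤ (univ.filter fun j => (κ ^ p) j = j).card ∧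
    (univ.filter fun j => (κ ^ q) j = j ∧ (κ ^ p) j = j).card ≤ (univ.filter fun j => (κ ^ q) j = j).card := by
  have hσ : (κ ^ q) ^ p = 1 := by rw [← pow_mul, mul_comm]; exact hκ
  have hh : (κ ^ p) ^ q = 1 := by rw [← pow_mul]; exact hκ
  refine ⟨?_, ?_, ?_, ?_, ?_, ?_⟩
  · rw [card_filter_split (fun j => (κ ^ p) j = j) (fun j => (κ ^ q) j = j), add_comm]
    have e1 : (univ.filter fun j => (κ ^ p) j = j ∧ ¬ (κ ^ q) j = j)
        = univ.filter fun j => (κ ^ q) j ≠ j ∧ (κ ^ p) j = j :=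
      Finset.filter_congr (fun j _ => ⟨fun h => ⟨h.2, h.1⟩, fun h => ⟨h.2, h.1⟩⟩)
    have e2 : (univ.filter fun j => (κ ^ p) j = j ∧ (κ ^ q) j = j)
        = univ.filter fun j => (κ ^ q) j = j ∧ (κ ^ p) j = j :=
      Finset.filter_congr (fun j _ => ⟨fun h => ⟨h.2, h.1⟩, fun h => ⟨h.2, h.1⟩⟩)
    rw [e1, e2]
  · exact dvd_card_moved_fixed (κ ^ q) (κ ^ p) hp hσ (fun j => perm_pow_comm_apply κ q p j)
  · rw [card_filter_split (fun j => (κ ^ q) j = j) (fun j => (κ ^ p) j = j), add_comm]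
    have e1 : (univ.filter fun j => (κ ^ q) j = j ∧ ¬ (κ ^ p) j = j)
        = univ.filter fun j => (κ ^ p) j ≠ j ∧ (κ ^ q) j = j :=
      Finset.filter_congr (fun j _ => ⟨fun h => ⟨h.2, h.1⟩, fun h => ⟨h.2, h.1⟩⟩)
    rw [e1]
  · exact dvd_card_moved_fixed (κ ^ p) (κ ^ q) hq hh (fun j => perm_pow_comm_apply κ p q j)
  · exact Finset.card_le_card (fun j => by simp only [Finset.mem_filter, Finset.mem_univ, true_and]; exact And.right)
  · exact Finset.card_le_card (fun j => by simp only [Finset.mem_filter, Finset.mem_univ, true_and]; exact And.left)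

section main
variable {H : Matrix ι ι ℤ} {π κ : Equiv.Perm ι}

/-- **Two distinct primes `p, q ≥ 13`: no permutation automorphism pair of order `p·q`.** -/
theorem no_unsignedAut_order_two_primes_ge_13 (hH : IsHadamardMatrix H) (hι : Fintype.card ι = 668)
    (hA : ∀ i j, H (π i) (κ j) = H i j) {p q : ℕ} (hp : p.Prime) (hq : q.Prime) (hpq : p ≠ q)
    (hp13 : 13 ≤ p) (hq13 : 13 ≤ q) (hπ : π ^ (p * q) = 1) (hκ : κ ^ (p * q) = 1)
    (hσ : π ^ q ≠ 1 ∨ κ ^ q ≠ 1) (hh : π ^ p ≠ 1 ∨ κ ^ p ≠ 1) : False := by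
  obtain ⟨e1, d1⟩ := hadamard668_signedAut_fixedRows hH hι p hp hp13 (π ^ q) (κ ^ q) _ _
    (isSignedAut_pow_of_unsigned hA q) (by rw [← pow_mul, mul_comm]; exact hπ) (by rw [← pow_mul, mul_comm]; exact hκ) hσ
  obtain ⟨e2, d2⟩ := hadamard668_signedAut_fixedRows hH hι q hq hq13 (π ^ p) (κ ^ p) _ _
    (isSignedAut_pow_of_unsigned hA p) (by rw [← pow_mul]; exact hπ) (by rw [← pow_mul]; exact hκ) hh
  obtain ⟨s1, dA, s2, dB, l1, l2⟩ := counting_cols κ hp hq hκ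
  rw [e1] at d1
  rw [e2] at d2
  rcases d1 with ⟨rfl, h1⟩ | ⟨rfl, h1⟩ | ⟨rfl, h1⟩ | ⟨rfl, h1⟩ | ⟨rfl, h1⟩ | ⟨rfl, h1⟩ <;>
  rcases d2 with ⟨rfl, h2⟩ | ⟨rfl, h2⟩ | ⟨rfl, h2⟩ | ⟨rfl, h2⟩ | ⟨rfl, h2⟩ | ⟨rfl, h2⟩ <;> omega

/-- **Small prime times large prime: no permutation automorphism pair of order `p·q` for the thirteen listed pairs.** -/
theorem no_unsignedAut_order_small_large (hH : IsHadamardMatrix H) (hι : Fintype.card ι = 668)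
    (hA : ∀ i j, H (π i) (κ j) = H i j) {p q : ℕ} (hpq : (p, q) ∈ ([(5, 37), (7, 37), (11, 37), (7, 41), (11, 41), (3, 83), (5, 83), (7, 83), (11, 83), (3, 167), (5, 167), (7, 167), (11, 167)] : List (ℕ × ℕ)))
    (hπ : π ^ (p * q) = 1) (hκ : κ ^ (p * q) = 1)
    (hσ : π ^ q ≠ 1 ∨ κ ^ q ≠ 1) (hh : π ^ p ≠ 1 ∨ κ ^ p ≠ 1) : False := by
  simp only [List.mem_cons, Prod.mk.injEq, List.mem_nil_iff, or_false] at hpq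
  have hmem : p = 3 ∨ p = 5 ∨ p = 7 ∨ p = 11 := by omega
  have hqv : q = 37 ∨ q = 41 ∨ q = 83 ∨ q = 167 := by omega
  have hp : p.Prime := by rcases hmem with rfl | rfl | rfl | rfl <;> norm_num
  have hq : q.Prime := by rcases hqv with rfl | rfl | rfl | rfl <;> norm_num
  have hq13 : 13 ≤ q := by omega
  -- the q-part (π^p, κ^p): fixed structure from the table
  obtain ⟨e2, d2⟩ := hadamard668_signedAut_fixedRows hH hι q hq hq13 (π ^ p) (κ ^ p) _ _
    (isSignedAut_pow_of_unsigned hA p) (by rw [← pow_mul]; exact hπ) (by rw [← pow_mul]; exact hκ) hh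
  rw [e2] at d2
  -- the p-part (π^q, κ^q): window
  have hσp : (π ^ q) ^ p = 1 := by rw [← pow_mul, mul_comm]; exact hπ
  have hκp : (κ ^ q) ^ p = 1 := by rw [← pow_mul, mul_comm]; exact hκ
  obtain ⟨-, w3, w5, w7, w11⟩ := hadamard668_signedAut_colClasses_window hH hι hmem (π ^ q) (κ ^ q) _ _
    (isSignedAut_pow_of_unsigned hA q) hσp hκp hσ
  have hcl := card_fixed_add_classes (κ ^ q) hp hκp
  rw [hι] at hcl
  obtain ⟨s1, dA, s2, dB, l1, l2⟩ := counting_cols κ hp hq hκ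
  rcases hpq with ⟨rfl, rfl⟩ | ⟨rfl, rfl⟩ | ⟨rfl, rfl⟩ | ⟨rfl, rfl⟩ | ⟨rfl, rfl⟩ | ⟨rfl, rfl⟩ | ⟨rfl, rfl⟩ |
      ⟨rfl, rfl⟩ | ⟨rfl, rfl⟩ | ⟨rfl, rfl⟩ | ⟨rfl, rfl⟩ | ⟨rfl, rfl⟩ | ⟨rfl, rfl⟩ <;>
    first
    | (have hw := w3 rfl; rcases d2 with ⟨h, h2⟩ | ⟨h, h2⟩ | ⟨h, h2⟩ | ⟨h, h2⟩ | ⟨h, h2⟩ | ⟨h, h2⟩ <;> omega)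
    | (have hw := w5 rfl; rcases d2 with ⟨h, h2⟩ | ⟨h, h2⟩ | ⟨h, h2⟩ | ⟨h, h2⟩ | ⟨h, h2⟩ | ⟨h, h2⟩ <;> omega)
    | (have hw := w7 rfl; rcases d2 with ⟨h, h2⟩ | ⟨h, h2⟩ | ⟨h, h2⟩ | ⟨h, h2⟩ | ⟨h, h2⟩ | ⟨h, h2⟩ <;> omega)
    | (have hw := w11 rfl; rcases d2 with ⟨h, h2⟩ | ⟨h, h2⟩ | ⟨h, h2⟩ | ⟨h, h2⟩ | ⟨h, h2⟩ | ⟨h, h2⟩ <;> omega)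

omit [Fintype ι] [DecidableEq ι] in
/-- powers of a signed automorphism are signed automorphisms (signs = partial cycle products) -/
lemma isSignedAut_pow {d e : ι → ℤ} (haut : IsSignedAut H π κ d e) (k : ℕ) :
    IsSignedAut H (π ^ k) (κ ^ k) (fun i => cyc π d i k) (fun j => cyc κ e j k) :=
  ⟨fun i => cyc_pm π d haut.1 i k, fun j => cyc_pm κ e haut.2.1 j k, fun i j => signedAut_pow haut k i j⟩

omit [DecidableEq ι] in
/-- **power trick**: if `p·q` divides the order of the pair `(π, κ)` of a signed automorphism, some power is a signed
automorphism whose pair has order exactly `p·q`, hence `π'^(pq) = κ'^(pq) = 1` with both parts nontrivial -/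
lemma exists_pow_of_dvd_orderOf {d e : ι → ℤ} (haut : IsSignedAut H π κ d e) {p q : ℕ} (hp : p.Prime) (hq : q.Prime)
    (hdvd : p * q ∣ orderOf ((π, κ) : Equiv.Perm ι × Equiv.Perm ι)) :
    ∃ (π' κ' : Equiv.Perm ι) (d' e' : ι → ℤ), IsSignedAut H π' κ' d' e' ∧
      π' ^ (p * q) = 1 ∧ κ' ^ (p * q) = 1 ∧ (π' ^ q ≠ 1 ∨ κ' ^ q ≠ 1) ∧ (π' ^ p ≠ 1 ∨ κ' ^ p ≠ 1) := by
  set x : Equiv.Perm ι × Equiv.Perm ι := (π, κ) with hx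
  have hx0 : orderOf x ≠ 0 := (orderOf_pos x).ne'
  set k := orderOf x / (p * q) with hk
  have hord : orderOf (x ^ k) = p * q := orderOf_pow_orderOf_div hx0 hdvd
  have hxk : x ^ k = ((π ^ k, κ ^ k) : Equiv.Perm ι × Equiv.Perm ι) := by rw [hx, Prod.pow_mk]
  rw [hxk] at hord
  have hp1 : 1 < p := hp.one_lt
  have hq1 : 1 < q := hq.one_lt
  obtain ⟨h1, h2, h3⟩ := pow_data_of_orderOf hord (a := q) hq.pos
    (by nlinarith)
  obtain ⟨-, -, h4⟩ := pow_data_of_orderOf hord (a := p) hp.pos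
    (by nlinarith)
  exact ⟨π ^ k, κ ^ k, _, _, isSignedAut_pow haut k, h1, h2, h3, h4⟩

/-- **Signed form, primes `≥ 13`.**  For a signed automorphism `(π, κ, d, e)` of a Hadamard matrix of order `668` and distinct
primes `p, q ≥ 13`: `p·q` does not divide the order of `(π, κ)`. -/
theorem no_hadamard668_signedAut_order_two_primes_ge_13 (hH : IsHadamardMatrix H) (hι : Fintype.card ι = 668)
    (π κ : Equiv.Perm ι) (d e : ι → ℤ) (haut : IsSignedAut H π κ d e) {p q : ℕ} (hp : p.Prime) (hq : q.Prime)
    (hpq : p ≠ q) (hp13 : 13 ≤ p) (hq13 : 13 ≤ q)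
    (hdvd : p * q ∣ orderOf ((π, κ) : Equiv.Perm ι × Equiv.Perm ι)) : False := by
  obtain ⟨π', κ', d', e', haut', h1, h2, h3, h4⟩ := exists_pow_of_dvd_orderOf haut hp hq hdvd
  have hodd : Odd (p * q) := Nat.odd_mul.mpr ⟨hp.odd_of_ne_two (by omega), hq.odd_of_ne_two (by omega)⟩
  obtain ⟨H', hH', hA⟩ := exists_unsigned_of_signedAut hH haut' hodd h1 h2
  exact no_unsignedAut_order_two_primes_ge_13 hH' hι hA hp hq hpq hp13 hq13 h1 h2 h3 h4

/-- **Signed form, the thirteen small × large pairs.** -/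
theorem no_hadamard668_signedAut_order_small_large (hH : IsHadamardMatrix H) (hι : Fintype.card ι = 668)
    (π κ : Equiv.Perm ι) (d e : ι → ℤ) (haut : IsSignedAut H π κ d e) {p q : ℕ} (hpq : (p, q) ∈ ([(5, 37), (7, 37), (11, 37), (7, 41), (11, 41), (3, 83), (5, 83), (7, 83), (11, 83), (3, 167), (5, 167), (7, 167), (11, 167)] : List (ℕ × ℕ)))
    (hdvd : p * q ∣ orderOf ((π, κ) : Equiv.Perm ι × Equiv.Perm ι)) : False := by
  have hpq' := hpq
  simp only [List.mem_cons, Prod.mk.injEq, List.mem_nil_iff, or_false] at hpq'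
  have hmem : p = 3 ∨ p = 5 ∨ p = 7 ∨ p = 11 := by omega
  have hqv : q = 37 ∨ q = 41 ∨ q = 83 ∨ q = 167 := by omega
  have hp : p.Prime := by rcases hmem with rfl | rfl | rfl | rfl <;> norm_num
  have hq : q.Prime := by rcases hqv with rfl | rfl | rfl | rfl <;> norm_num
  obtain ⟨π', κ', d', e', haut', h1, h2, h3, h4⟩ := exists_pow_of_dvd_orderOf haut hp hq hdvd
  have hodd : Odd (p * q) := Nat.odd_mul.mpr ⟨hp.odd_of_ne_two (by omega), hq.odd_of_ne_two (by omega)⟩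
  obtain ⟨H', hH', hA⟩ := exists_unsigned_of_signedAut hH haut' hodd h1 h2
  exact no_unsignedAut_order_small_large hH' hι hA hpq h1 h2 h3 h4

/-- the excluded products with a factor `23` from `CompositeOrder23/161`, in divisibility form -/
theorem no_hadamard668_signedAut_order_23q (hH : IsHadamardMatrix H) (hι : Fintype.card ι = 668)
    (π κ : Equiv.Perm ι) (d e : ι → ℤ) (haut : IsSignedAut H π κ d e) {q : ℕ} (hq : q = 5 ∨ q = 7 ∨ q = 11)
    (hdvd : q * 23 ∣ orderOf ((π, κ) : Equiv.Perm ι × Equiv.Perm ι)) : False := by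
  have hqp : q.Prime := by rcases hq with rfl | rfl | rfl <;> norm_num
  obtain ⟨π', κ', d', e', haut', h1, h2, h3, h4⟩ := exists_pow_of_dvd_orderOf haut hqp (by norm_num : (23 : ℕ).Prime)
    hdvd
  rcases hq with rfl | rfl | rfl
  · exact no_hadamard668_signedAut_order115 hH hι π' κ' d' e' haut'
      (by rw [show (115 : ℕ) = 5 * 23 from rfl]; exact h1) (by rw [show (115 : ℕ) = 5 * 23 from rfl]; exact h2) h4 h3
  · exact no_hadamard668_signedAut_order161 hH hι π' κ' d' e' haut'
      (by rw [show (161 : ℕ) = 7 * 23 from rfl]; exact h1) (by rw [show (161 : ℕ) = 7 * 23 from rfl]; exact h2) h4 h3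
  · exact no_hadamard668_signedAut_order253 hH hι π' κ' d' e' haut'
      (by rw [show (253 : ℕ) = 11 * 23 from rfl]; exact h1) (by rw [show (253 : ℕ) = 11 * 23 from rfl]; exact h2) h4 h3

/-- **Composite-order table (summary).**  For every Hadamard matrix of order `668`, every signed automorphism `(π, κ, d, e)` and
every listed pair `(p, q)`: `p·q` does not divide the order of the permutation pair `(π, κ)`.  (Values: 115, 161, 253, 185, 259,
407, 287, 451, 249, 415, 581, 913, 501, 835, 1169, 1837, 299, 481, 533, 1079, 2171, 851, 943, 1909, 3841, 1517, 3071, 6179,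
3403, 6847, 13861.) -/
theorem hadamard668_signedAut_not_dvd_orderOf (hH : IsHadamardMatrix H) (hι : Fintype.card ι = 668)
    (π κ : Equiv.Perm ι) (d e : ι → ℤ) (haut : IsSignedAut H π κ d e) :
    ∀ pq ∈ ([(5, 23), (7, 23), (11, 23)] ++
      [(5, 37), (7, 37), (11, 37), (7, 41), (11, 41), (3, 83), (5, 83), (7, 83), (11, 83), (3, 167), (5, 167), (7, 167), (11, 167)] ++
      [(13, 23), (13, 37), (13, 41), (13, 83), (13, 167), (23, 37), (23, 41), (23, 83), (23, 167),
       (37, 41), (37, 83), (37, 167), (41, 83), (41, 167), (83, 167)] : List (ℕ × ℕ)),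
      ¬ pq.1 * pq.2 ∣ orderOf ((π, κ) : Equiv.Perm ι × Equiv.Perm ι) := by
  intro pq hmem hdvd
  simp only [List.mem_append] at hmem
  rcases hmem with (h23 | hsl) | hbig
  · simp only [List.mem_cons, List.mem_nil_iff, or_false] at h23
    rcases h23 with rfl | rfl | rfl
    · exact no_hadamard668_signedAut_order_23q hH hι π κ d e haut (q := 5) (by norm_num) hdvd
    · exact no_hadamard668_signedAut_order_23q hH hι π κ d e haut (q := 7) (by norm_num) hdvd
    · exact no_hadamard668_signedAut_order_23q hH hι π κ d e haut (q := 11) (by norm_num) hdvd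
  · obtain ⟨p, q⟩ := pq
    exact no_hadamard668_signedAut_order_small_large hH hι π κ d e haut hsl hdvd
  · obtain ⟨p, q⟩ := pq
    simp only [List.mem_cons, Prod.mk.injEq, List.mem_nil_iff, or_false] at hbig
    have hp : p.Prime ∧ 13 ≤ p := by
      rcases hbig with ⟨rfl, -⟩ | ⟨rfl, -⟩ | ⟨rfl, -⟩ | ⟨rfl, -⟩ | ⟨rfl, -⟩ | ⟨rfl, -⟩ | ⟨rfl, -⟩ | ⟨rfl, -⟩ |
        ⟨rfl, -⟩ | ⟨rfl, -⟩ | ⟨rfl, -⟩ | ⟨rfl, -⟩ | ⟨rfl, -⟩ | ⟨rfl, -⟩ | ⟨rfl, -⟩ <;> norm_num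
    have hq : q.Prime ∧ 13 ≤ q := by
      rcases hbig with ⟨-, rfl⟩ | ⟨-, rfl⟩ | ⟨-, rfl⟩ | ⟨-, rfl⟩ | ⟨-, rfl⟩ | ⟨-, rfl⟩ | ⟨-, rfl⟩ | ⟨-, rfl⟩ |
        ⟨-, rfl⟩ | ⟨-, rfl⟩ | ⟨-, rfl⟩ | ⟨-, rfl⟩ | ⟨-, rfl⟩ | ⟨-, rfl⟩ | ⟨-, rfl⟩ <;> norm_num
    have hne : p ≠ q := by omega
    exact no_hadamard668_signedAut_order_two_primes_ge_13 hH hι π κ d e haut hp.1 hq.1 hne hp.2 hq.2 hdvd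

end main

end Summit.Ventures.DiscreteObjects.Hadamard
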